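import Literature.NumberTheory.EllipticCurves.SubgroupSelmerCocycleCriteriaProofs
import Literature.NumberTheory.EllipticCurves.H1TrivialAction
import Literature.NumberTheory.EllipticCurves.GreenbergSelmer
import Literature.NumberTheory.EllipticCurves.ZpExtension
import Literature.NumberTheory.EllipticCurves.IwasawaDualModule
import Mathlib.NumberTheory.Padics.RingHoms
import HarnessLib

/-!
# An UNRAMIFIED local class at `v̄` that survives restriction to the line — from an auxiliary `ℤ_p`-character
# unramified at `v̄` (the local input of (Q ≠ 0) for S3d, class (iii); helper for crux stmt-BirchSwinnertonDyer-20368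
# `PrintCf2.SplitBadTwoRankOneOfFacts`; cell `bsd-print-cf2`, seat `bsd-line-cf2-p1-w7` g5)

Generic in the number field `K`, the prime `p`, the discrete `Γ_K`-module `M`, the place `v̄`, a subgroup
`N ≤ Γ_K` (in the application `N = ker κ′`, `K̄^N = K*_∞` the line) and an auxiliary `ℤ_p`-extension `κ₁`
(in the application the OTHER line `K(v^∞)`, unramified at `v̄`).  HYPOTHESES (all discharged on the road-α
class-(iii) frame in the sequel): `I_{v̄} ≤ ker κ₁` (unramified at `v̄`); `D_{v̄} ⊄ ker κ₁` (`v̄` does not split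
completely in `K̄^{ker κ₁}` — the tree's `ZpExtension.not_decomp_le_kerSubgroup_of_isImaginaryQuadratic`);
`D_{v̄} ⊆ I_{v̄}·N` (the line is totally ramified at `v̄`); `N ⊓ D_{v̄}` acts trivially on `M`; `M` has elements of
every order `p^n`; `D_{v̄}` fixes `M[p]`.
* **`exists_unramified_resOfLe_inf_ne_zero`** — THEN there is `τ ∈ H¹(D_{v̄}, M)` with `res_{D_{v̄} ⊓ I_{v̄}} τ = 0`
  (unramified) and `res_{N ⊓ D_{v̄}} τ ≠ 0`.  CONSTRUCTION: let `p^k` be the exact power dividing `κ₁(N ⊓ D_{v̄})`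
  (`= κ₁(D_{v̄})` by total ramification), `w ∈ M` of order `p^{k+1}`; the continuous homomorphism
  `f(δ) = (κ₁(δ) mod p^{k+1})·w : D_{v̄} → ℤ·p^k w ⊆ M[p] ⊆ M^{D_{v̄}}` is a 1-cocycle, trivial on `I_{v̄}`, and its
  restriction to `N ⊓ D_{v̄}` (a plain homomorphism, the action being trivial there, so coboundaries vanish) takes the
  value `p^k u·w ≠ 0` at an element of exact valuation `k`.
Auxiliary (with the tree's `IwasawaDual.mod_smul_eq`): `val_toZModPow_nsmul_add` / `exists_val_toZModPow_nsmul_eq` / `val_toZModPow_nsmul_ne_zero`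
(`ℤ/p^{k+1}`-bookkeeping), `exists_mem_inf_decomp_apply_eq` (total ramification moves `D_{v̄}` into `N ⊓ D_{v̄}`
without changing `κ₁`).

HONEST FRAMING: local algebra/cohomology only; closes nothing (`--supports`).  No named fact, no definition,
no `sorry`.  No summit statement is proved by this file; BSD is not proved by any of this.

References: Serre, Local Fields XIII §1 (unramified classes = homomorphisms of `D/I`); Greenberg–Vatsal 2000 §2
p. 17 (the local condition at `v̄`); Rubin 1991 §5 pp. 38–39 (decomposition groups of the primes above `p` are open
in the `ℤ_p`-extensions of an imaginary quadratic field).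
-/

-- the summit namespace `Summit.BirchSwinnertonDyer.BirchSwinnertonDyer` repeats the problem name by design (D-0017)
set_option linter.dupNamespace false
set_option autoImplicit false

noncomputable section

open scoped Classical
open NumberField IsDedekindDomain Field
open Literature.NumberTheory.EllipticCurves Literature.NumberTheory.EllipticCurves.GreenbergSelmer
open Literature.NumberTheory.GaloisRepresentations

namespace Summit.BirchSwinnertonDyer.BirchSwinnertonDyer.Theorems.PrintCf2.StrictDefectInfinite

/-! ## §1. `ℤ/p^{n}`-bookkeeping for the homomorphism `x ↦ (x mod p^{n})·w` -/

section ZModBookkeeping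

variable {A : Type*} [AddCommGroup A] {p : ℕ} [Fact p.Prime]

/-- Additivity of `x ↦ (x mod p^n).val·w` for `p^n·w = 0`. [folklore] -/
theorem val_toZModPow_nsmul_add {n : ℕ} {w : A} (hw : p ^ n • w = 0) (x y : ℤ_[p]) :
    (PadicInt.toZModPow n (x + y)).val • w =
      (PadicInt.toZModPow n x).val • w + (PadicInt.toZModPow n y).val • w := by
  rw [map_add, ZMod.val_add, IwasawaDual.mod_smul_eq hw, add_nsmul]

/-- If `p^k ∣ x` then `(x mod p^{k+1}).val·w` is a multiple of `p^k·w`. [folklore] -/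
theorem exists_val_toZModPow_nsmul_eq {k : ℕ} {w : A} (hw : p ^ (k + 1) • w = 0) {x : ℤ_[p]}
    (hx : (p : ℤ_[p]) ^ k ∣ x) : ∃ m : ℕ, (PadicInt.toZModPow (k + 1) x).val • w = m • (p ^ k • w) := by
  obtain ⟨y, rfl⟩ := hx
  refine ⟨(PadicInt.toZModPow (k + 1) y).val, ?_⟩
  have e : PadicInt.toZModPow (k + 1) ((p : ℤ_[p]) ^ k * y) =
      (((p ^ k * (PadicInt.toZModPow (k + 1) y).val : ℕ)) : ZMod (p ^ (k + 1))) := by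
    rw [map_mul, map_pow, map_natCast, Nat.cast_mul, Nat.cast_pow, ZMod.natCast_zmod_val]
  rw [e, ZMod.val_natCast, IwasawaDual.mod_smul_eq hw, mul_nsmul]

/-- If `x ≠ 0` has valuation exactly `k` and `w` has order `p^{k+1}`, then `(x mod p^{k+1}).val·w ≠ 0`. [folklore] -/
theorem val_toZModPow_nsmul_ne_zero {k : ℕ} {w : A} (hw : addOrderOf w = p ^ (k + 1)) {x : ℤ_[p]} (hx0 : x ≠ 0)
    (hxk : x.valuation = k) : (PadicInt.toZModPow (k + 1) x).val • w ≠ 0 := by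
  intro h
  have hdvd : p ^ (k + 1) ∣ (PadicInt.toZModPow (k + 1) x).val := by
    have h' := addOrderOf_dvd_of_nsmul_eq_zero h
    rwa [hw] at h'
  have hval : (PadicInt.toZModPow (k + 1) x).val = 0 :=
    Nat.eq_zero_of_dvd_of_lt hdvd (ZMod.val_lt _)
  have hzero : PadicInt.toZModPow (k + 1) x = 0 := (ZMod.val_eq_zero _).mp hval
  have hmem : x ∈ (Ideal.span {(p : ℤ_[p]) ^ (k + 1)} : Ideal ℤ_[p]) := by
    rw [← PadicInt.ker_toZModPow, RingHom.mem_ker]; exact hzero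
  rw [PadicInt.mem_span_pow_iff_le_valuation x hx0, hxk] at hmem
  omega

end ZModBookkeeping

/-! ## §2. Total ramification moves `D_{v̄}` into `N ⊓ D_{v̄}` without changing `κ₁` -/

section Galois

variable {K : Type} [Field K] [NumberField K] {p : ℕ} [Fact p.Prime]

/-- **`κ₁(D_{v̄}) = κ₁(N ⊓ D_{v̄})`** when `I_{v̄} ≤ ker κ₁` and `D_{v̄} ⊆ I_{v̄}·N`: every `d ∈ D_{v̄}` is `i·δ` with
`i ∈ I_{v̄}`, `δ ∈ N ⊓ D_{v̄}`, and `κ₁ δ = κ₁ d`. [folklore] -/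
theorem exists_mem_inf_decomp_apply_eq (κ₁ : ZpExtension K p) (N : Subgroup (absoluteGaloisGroup K))
    {vbar : HeightOneSpectrum (𝓞 K)} (hI : inertia vbar ≤ κ₁.kerSubgroup)
    (htot : ∀ d ∈ decomp (K := K) vbar, ∃ i ∈ inertia vbar, i⁻¹ * d ∈ N)
    {d : absoluteGaloisGroup K} (hd : d ∈ decomp (K := K) vbar) :
    ∃ δ ∈ N ⊓ decomp (K := K) vbar, κ₁ δ = κ₁ d := by
  obtain ⟨i, hi, hiN⟩ := htot d hd
  refine ⟨i⁻¹ * d, ⟨hiN, Subgroup.mul_mem _ (Subgroup.inv_mem _ (inertia_le_decomp vbar hi)) hd⟩, ?_⟩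
  have h1 : κ₁ i = 1 := ZpExtension.mem_kerSubgroup.mp (hI hi)
  rw [map_mul, map_inv, h1, inv_one, one_mul]

end Galois

/-! ## §3. The unramified class -/

section LocalClass

variable {K : Type} [Field K] [NumberField K] {p : ℕ} [Fact p.Prime]
  (M : Type) [AddCommGroup M] [DistribMulAction (absoluteGaloisGroup K) M] [TopologicalSpace M]
  [DiscreteTopology M]

/-- **An unramified class at `v̄` non-zero on `N ⊓ D_{v̄}`.**  Let `κ₁` be a `ℤ_p`-extension with
`I_{v̄} ≤ ker κ₁` and `D_{v̄} ⊄ ker κ₁`, `N ≤ Γ_K` with `D_{v̄} ⊆ I_{v̄}·N` and `N ⊓ D_{v̄}` acting trivially on `M`,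
and suppose `M` has elements of every order `p^n` and `D_{v̄}` fixes `M[p]`.  Then some `τ ∈ H¹(D_{v̄}, M)` has
`res_{D_{v̄} ⊓ I_{v̄}} τ = 0` and `res_{N ⊓ D_{v̄}} τ ≠ 0` — the class of the homomorphism
`δ ↦ (κ₁ δ mod p^{k+1})·w` (`p^k ∥ κ₁(D_{v̄})`, `w` of order `p^{k+1}`), valued in `ℤ·p^k w ⊆ M[p] ⊆ M^{D_{v̄}}`.
[cite: SerreLocalFields1979, XIII §1 Prop. 1] [cite: GreenbergVatsal2000, §2 p. 17] -/
theorem exists_unramified_resOfLe_inf_ne_zero (κ₁ : ZpExtension K p) (N : Subgroup (absoluteGaloisGroup K))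
    {vbar : HeightOneSpectrum (𝓞 K)} (hI : inertia vbar ≤ κ₁.kerSubgroup)
    (hD : ¬ decomp (K := K) vbar ≤ κ₁.kerSubgroup)
    (htot : ∀ d ∈ decomp (K := K) vbar, ∃ i ∈ inertia vbar, i⁻¹ * d ∈ N)
    (htriv : ∀ δ ∈ N ⊓ decomp (K := K) vbar, ∀ m : M, δ • m = m)
    (hdiv : ∀ n : ℕ, ∃ w : M, addOrderOf w = p ^ n)
    (hfix : ∀ d ∈ decomp (K := K) vbar, ∀ m : M, p • m = 0 → d • m = m) :
    ∃ τ : subgroupH1 (decomp (K := K) vbar) M,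
      resOfLe M (inf_le_left : decomp vbar ⊓ inertia vbar ≤ decomp vbar) τ = 0 ∧
      resOfLe M (inf_le_right : N ⊓ decomp vbar ≤ decomp vbar) τ ≠ 0 := by
  have hp : p.Prime := Fact.out
  -- (1) an element of `N ⊓ D_{v̄}` on which `κ₁` is non-trivial; the minimal valuation `k`
  obtain ⟨d₀, hd₀D, hd₀⟩ : ∃ d ∈ decomp (K := K) vbar, d ∉ κ₁.kerSubgroup := Set.not_subset.mp hD
  have hP : ∃ k : ℕ, ∃ δ ∈ N ⊓ decomp (K := K) vbar, κ₁ δ ≠ 1 ∧ ((κ₁ δ).toAdd).valuation = k := by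
    obtain ⟨δ, hδ, hδd⟩ := exists_mem_inf_decomp_apply_eq κ₁ N hI htot hd₀D
    exact ⟨_, δ, hδ, by rw [hδd]; exact fun h ↦ hd₀ (ZpExtension.mem_kerSubgroup.mpr h), rfl⟩
  set k : ℕ := Nat.find hP with hk
  obtain ⟨δ₁, hδ₁, hδ₁ne, hδ₁val⟩ := Nat.find_spec hP
  have hmin : ∀ δ ∈ N ⊓ decomp (K := K) vbar, κ₁ δ ≠ 1 → k ≤ ((κ₁ δ).toAdd).valuation :=
    fun δ hδ hne ↦ (Nat.find_le ⟨δ, hδ, hne, rfl⟩ : Nat.find hP ≤ _)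
  -- (2) `p^k ∣ κ₁ d` for every `d ∈ D_{v̄}`
  have hdvd : ∀ d ∈ decomp (K := K) vbar, (p : ℤ_[p]) ^ k ∣ (κ₁ d).toAdd := by
    intro d hd
    obtain ⟨δ, hδ, hδd⟩ := exists_mem_inf_decomp_apply_eq κ₁ N hI htot hd
    rw [← hδd]
    by_cases h1 : κ₁ δ = 1
    · rw [h1, toAdd_one]; exact dvd_zero _
    · have h0 : (κ₁ δ).toAdd ≠ 0 := fun h ↦ h1 (toAdd_eq_zero.mp h)
      exact Ideal.mem_span_singleton.mp ((PadicInt.mem_span_pow_iff_le_valuation _ h0 k).mpr (hmin δ hδ h1))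
  -- (3) the coefficient `w` of order `p^{k+1}`; `p^k w` is fixed by `D_{v̄}`
  obtain ⟨w, hw⟩ := hdiv (k + 1)
  have hw0 : p ^ (k + 1) • w = 0 := by rw [← hw]; exact addOrderOf_nsmul_eq_zero w
  have hpw : p • (p ^ k • w) = 0 := by rw [← mul_nsmul, ← pow_succ, hw0]
  have hfixw : ∀ d ∈ decomp (K := K) vbar, d • (p ^ k • w) = p ^ k • w := fun d hd ↦ hfix d hd _ hpw
  -- (4) the homomorphism `f(δ) = (κ₁ δ mod p^{k+1})·w` on `D_{v̄}`
  let f : ↥(decomp (K := K) vbar) → M := fun δ ↦ (PadicInt.toZModPow (k + 1) ((κ₁ (δ : absoluteGaloisGroup K)).toAdd)).val • w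
  have hfmul : ∀ a b, f (a * b) = f a + f b := by
    intro a b
    simp only [f, Subgroup.coe_mul, map_mul, toAdd_mul, val_toZModPow_nsmul_add hw0]
  have hffix : ∀ (a b : ↥(decomp (K := K) vbar)), (a : absoluteGaloisGroup K) • f b = f b := by
    intro a b
    obtain ⟨m, hm⟩ := exists_val_toZModPow_nsmul_eq hw0 (hdvd b b.2)
    simp only [f]
    rw [hm]
    change DistribSMul.toAddMonoidHom M (a : absoluteGaloisGroup K) (m • (p ^ k • w)) = _
    rw [map_nsmul]
    change m • ((a : absoluteGaloisGroup K) • (p ^ k • w)) = _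
    rw [hfixw a a.2]
  have hfzero : ∀ a : ↥(decomp (K := K) vbar), κ₁ (a : absoluteGaloisGroup K) = 1 → f a = 0 := by
    intro a ha
    simp only [f, ha, toAdd_one, map_zero, ZMod.val_zero, zero_nsmul]
  -- continuity: `f` vanishes on the open subgroup `D_{v̄} ⊓ κ₁⁻¹(p^{k+1} ℤ_p)`
  have hcont : Continuous f := by
    refine continuous_of_map_mul_of_subgroup hfmul ((κ₁.layerSubgroup (k + 1)).subgroupOf (decomp vbar)) ?_ ?_
    · rw [Subgroup.coe_subgroupOf]
      exact (κ₁.isOpen_layerSubgroup (k + 1)).preimage continuous_subtype_val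
    · intro u hu
      rw [Subgroup.mem_subgroupOf, ZpExtension.mem_layerSubgroup] at hu
      have h0 : PadicInt.toZModPow (k + 1) ((κ₁ (u : absoluteGaloisGroup K)).toAdd) = 0 := by
        rw [← RingHom.mem_ker, PadicInt.ker_toZModPow]; exact Ideal.mem_span_singleton.mpr hu
      simp only [f, h0, ZMod.val_zero, zero_nsmul]
  -- (5) the cocycle and its class
  let z : contOneCocycles (discreteTopRep ↥(decomp (K := K) vbar) M) :=
    ⟨⟨f, hcont⟩, fun a b ↦ by
      change f (a * b) = f a + (a : absoluteGaloisGroup K) • f b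
      rw [hfmul, hffix]⟩
  refine ⟨oneCocycleClass _ z, ?_, ?_⟩
  · -- unramified: `f` vanishes on `D_{v̄} ⊓ I_{v̄}` (`I_{v̄} ≤ ker κ₁`)
    refine (CocycleCriteria.resOfLe_oneCocycleClass_eq_zero_iff _ z).mpr ⟨0, fun x ↦ ?_⟩
    rw [smul_zero, sub_zero]
    exact hfzero _ (ZpExtension.mem_kerSubgroup.mp (hI x.2.2))
  · -- non-zero on `N ⊓ D_{v̄}`: coboundaries vanish there and `f δ₁ ≠ 0`
    intro hzero
    obtain ⟨a, ha⟩ := (CocycleCriteria.resOfLe_oneCocycleClass_eq_zero_iff _ z).mp hzero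
    have h1 : f ⟨δ₁, hδ₁.2⟩ = 0 := by
      have := ha ⟨δ₁, hδ₁⟩
      rw [htriv δ₁ hδ₁ a, sub_self] at this
      exact this
    have hne0 : (κ₁ δ₁).toAdd ≠ 0 := fun h ↦ hδ₁ne (toAdd_eq_zero.mp h)
    exact val_toZModPow_nsmul_ne_zero hw hne0 hδ₁val h1

end LocalClass

end Summit.BirchSwinnertonDyer.BirchSwinnertonDyer.Theorems.PrintCf2.StrictDefectInfinite

end
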